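import Summits.QuantumFields.YangMills.Theorems.FluctuationComparisonRegPrIntLS2BetaArcBondSplit
import Mathlib.MeasureTheory.Measure.Lebesgue.VolumeOfBalls
import HarnessLib

/-!
# (BG∞) ∕ `hsupp⁺` — LEMMA (G4) OF UV3-NODE §116.4, BY HAAR VOLUME: A FINITE FAMILY OF ARC-BALLS OF RADIUS `ρ` WITH `card · (2∕(3π))·ρ³ < 1` DOES NOT COVER `SU(2)`
# — so finitely many cap-centres MISS A POINT, and a PATCHED finite family (every member within `r∕2` of one of the centres) stays `≥ r` away from it

Cell `ym3-torus` (YM ladder rung R3 = continuum `SU(2)` Yang–Mills on the three-torus at fixed lattice data — a RUNG: NOT d = 4, NOT infinite volume, NOT a mass gap,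
NOT Clay).  Width seat «width 5» `ym3-torus-px5` (gen 24), FREE px helper on crux `stmt-QuantumFields-20520` (`…Theses.UnitScaleTilt.FluctuationComparisonRegPrIntL`);
`--kind proof --supports stmt-QuantumFields-20520 --as helper`, count-neutral, DEFINITION-FREE (0 `def`, 0 `instance`, 0 `notation`, 0 `sorry`; default heartbeats).

WHY (architect-lineage RULING «(BG∞) PLAN OF RECORD = UV3-NODE §116» 2026-09-01 00:13:02Z; «(G4) OPEN … px5 second if (G3) lands early» 00:19:52Z; MINE 00:20Z).  Stages T and S
of the 8-colour gluing (px19 g25 §116.3) fill a discrete annulus ∕ sphere of group elements by CONING toward the antipode of a point `p` that the boundary image MISSES by a fixed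
arc `r`: the image is finite (one group element per boundary SITE) and clustered (step bound ⟹ `O(1)` PATCHES of radius `r∕2`), so one needs «a finite family of `P` patch-centres
leaves a point at arc `≥ 3r∕2` from all of them when `P` is below a universal count».  §116.3 (G4) proposed a PACKING count (`3r`-separated family of size `0.15∕r³` + pigeonhole);
THIS FILE proves it by VOLUME instead, over the tree's Haar-through-the-exponential-chart kit (lit ✓`T4HaarSU2ExpChart.haarProbability_image` «`Haar(expPoint″A) = ∫_A w_exp`»,
✓`expWeight_le` «`w_exp ≤ (2π²)⁻¹`», Mathlib `EuclideanSpace.volume_ball_fin_three`, left invariance of `haarProbability = haarMeasure ⊤`): an arc-ball of radius `ρ` has Haar mass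
`≤ (2π²)⁻¹·(4π∕3)ρ³ = (2∕(3π))·ρ³`, a union of `P` of them `< 1 = Haar(SU(2))` when `P·(2∕(3π))ρ³ < 1`, so the complement is non-empty — count `P < 3π∕(2ρ³) = 4.71∕ρ³`
(at `ρ = 3r∕2`: `P < 1.40∕r³`, nine times the packing count; `r_T`, `r_S` of §116.3 improve by `9^{1∕3}`).

WHAT IS PROVED (sorry-free; `SU2 = Matrix.specialUnitaryGroup (Fin 2) ℂ`, arc `= ‖logVec (su2Quat ·)‖`).
§1 ★`arcBall_subset_image` (`{p | arc(c⁻¹p) < ρ} ⊆ c • expPoint″(ball 0 ρ)`, lit ✓`expPoint_logVec`), ★`integral_expWeight_ball_le` (`∫_{ball 0 ρ} w_exp ≤ (2π²)⁻¹·(4π∕3)·ρ³`),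
  ★★`haarProbability_arcBall_le` (`Haar {p | arc(c⁻¹p) < ρ} ≤ ENNReal.ofReal ((2∕(3π))·ρ³)` for `0 ≤ ρ ≤ π`; left invariance + §1).
§2 ★★★`exists_forall_le_arc` (`[Fintype ι] (c : ι → SU2)`, `0 ≤ ρ ≤ π`, `(Fintype.card ι : ℝ) * ((2 ∕ (3π)) * ρ^3) < 1` ⟹ `∃ p, ∀ i, ρ ≤ ‖logVec (su2Quat ((c i)⁻¹ * p))‖` — union bound
  against `Haar univ = 1`).
§3 ★★★`exists_forall_le_arc_of_patched` (px19's consumer form: a family `φ : κ → SU2` PATCHED by the centres, `∀ k, ∃ i, arc((c i)⁻¹ φ k) ≤ r∕2`, with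
  `card ι · (2∕(3π))·(3r∕2)³ < 1`, `0 ≤ r`, `3r∕2 ≤ π` ⟹ `∃ p, ∀ k, r ≤ ‖logVec (su2Quat ((φ k)⁻¹ * p))‖` — arc subadditivity ✓`…ArcBondSplit.norm_logVec_su2Quat_mul_le`).

DOMAIN SENTENCE (RULING №115 R5).  Pure `SU(2)` measure geometry; all finite families; the patch structure is a HYPOTHESIS (its construction from a step bound is (G7)'s grid bookkeeping).
Nothing of the lattice, of the blocks, of `hsupp⁺` itself.

HONEST SCOPE.  [folklore] «finitely many small balls do not cover the 3-sphere», via the tree's Haar∕exp-chart theorems and Mathlib's ball volume; `hsupp⁺` ∕ (BG∞) is a CONJECTURE with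
a plan (§116) and numerics (FL-39), NOT proved; (G6)–(G8) OPEN; nothing of Bałaban's renormalisation-group analysis asserted or proved ([Balaban1985RegularSpaces] (1.29) p.81 is the
printed LOCAL gauge the road globalises); `hsupp^{≥J₀}`, hD, hDBX, h3 HYPOTHESES; GAP♯∘ (registry v11 3732b7df; v12.1 adopted-in-waiting), the five registered stubs (0∕5), S2β,
20520, 19936, 19200, `YM3TorusSU2` NOT proved; no registered stub closed; rung R3 — NOT d = 4, NOT infinite volume, NOT a mass gap, NOT Clay; the Yang–Mills mass gap is NOT proved.
-/

set_option autoImplicit false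

noncomputable section

namespace Summit.QuantumFields.YangMills.Theorems.FluctuationComparisonRegPrIntLS2BetaHaarCapComplement

open scoped Real
open Set MeasureTheory Metric
open Literature.MathematicalPhysics.QuantumLattice (su2Quat)
open Literature.MathematicalPhysics.QuantumFieldTheory (haarProbability)
open Literature.MathematicalPhysics.QuantumFieldTheory.Balaban1983to89
open T4CubeChartGnomonic (SU2)
open T4HaarSU2ExpChart (expPoint haarProbability_image expWeight expWeight_le expWeight_nonneg continuous_expWeight)
open T4ExpWindowSmallField (logVec expPoint_logVec)
open Summit.QuantumFields.YangMills.Theorems.FluctuationComparisonRegPrIntLS2BetaArcBondSplit (norm_logVec_su2Quat_mul_le)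

/-! ## §1 The Haar mass of an arc-ball -/

/-- ★ The arc-ball of radius `ρ` about `c` lies in the left translate by `c` of the chart window `expPoint″(ball 0 ρ)` (write `p = c · expPoint (logVec (c⁻¹p))`). [folklore] -/
theorem arcBall_subset_image (c : SU2) (ρ : ℝ) :
    {p : SU2 | ‖logVec (su2Quat (c⁻¹ * p))‖ < ρ} ⊆ (fun q : SU2 => c * q) '' (expPoint '' ball (0 : EuclideanSpace ℝ (Fin 3)) ρ) := by
  intro p hp
  exact ⟨c⁻¹ * p, ⟨logVec (su2Quat (c⁻¹ * p)), mem_ball_zero_iff.2 hp, expPoint_logVec _⟩, mul_inv_cancel_left _ _⟩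

/-- ★ The chart weight integrates over the ball of radius `ρ ≥ 0` to at most `(2π²)⁻¹ · (4π∕3) ρ³` (lit ✓`expWeight_le`, Mathlib `EuclideanSpace.volume_ball_fin_three`). [folklore] -/
theorem integral_expWeight_ball_le {ρ : ℝ} (hρ : 0 ≤ ρ) :
    ∫ x in ball (0 : EuclideanSpace ℝ (Fin 3)) ρ, expWeight x ≤ (2 * π ^ 2)⁻¹ * (π * 4 / 3 * ρ ^ 3) := by
  have hvol : (volume (ball (0 : EuclideanSpace ℝ (Fin 3)) ρ)).toReal = π * 4 / 3 * ρ ^ 3 := by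
    rw [EuclideanSpace.volume_ball_fin_three, ENNReal.toReal_mul, ENNReal.toReal_pow, ENNReal.toReal_ofReal hρ,
      ENNReal.toReal_ofReal (by positivity)]
    ring
  have hfin : volume (ball (0 : EuclideanSpace ℝ (Fin 3)) ρ) < ⊤ := measure_ball_lt_top
  have hint : IntegrableOn expWeight (ball (0 : EuclideanSpace ℝ (Fin 3)) ρ) volume :=
    Measure.integrableOn_of_bounded hfin.ne continuous_expWeight.aestronglyMeasurable
      (Filter.Eventually.of_forall fun x => by rw [Real.norm_of_nonneg (expWeight_nonneg x)]; exact expWeight_le x)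
  calc ∫ x in ball (0 : EuclideanSpace ℝ (Fin 3)) ρ, expWeight x
      ≤ ∫ _ in ball (0 : EuclideanSpace ℝ (Fin 3)) ρ, (2 * π ^ 2)⁻¹ :=
        setIntegral_mono hint (integrableOn_const hfin.ne) fun x => expWeight_le x
    _ = (2 * π ^ 2)⁻¹ * (π * 4 / 3 * ρ ^ 3) := by
        rw [setIntegral_const, Measure.real, hvol, smul_eq_mul, mul_comm]

/-- ★★ **THE HAAR MASS OF AN ARC-BALL**: `Haar {p | arc(c⁻¹p) < ρ} ≤ (2∕(3π))·ρ³` for `0 ≤ ρ ≤ π` (left invariance of `haarProbability = haarMeasure ⊤`, §1, and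
`(2π²)⁻¹·(4π∕3) = 2∕(3π)`). [folklore] -/
theorem haarProbability_arcBall_le (c : SU2) {ρ : ℝ} (hρ0 : 0 ≤ ρ) (hρπ : ρ ≤ π) :
    haarProbability SU2 {p : SU2 | ‖logVec (su2Quat (c⁻¹ * p))‖ < ρ} ≤ ENNReal.ofReal (2 / (3 * π) * ρ ^ 3) := by
  haveI : (haarProbability SU2).IsMulLeftInvariant := by unfold haarProbability; infer_instance
  have hπ : 0 < π := Real.pi_pos
  have hsub : ball (0 : EuclideanSpace ℝ (Fin 3)) ρ ⊆ ball 0 π := ball_subset_ball hρπ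
  calc haarProbability SU2 {p : SU2 | ‖logVec (su2Quat (c⁻¹ * p))‖ < ρ}
      ≤ haarProbability SU2 ((fun q : SU2 => c * q) '' (expPoint '' ball (0 : EuclideanSpace ℝ (Fin 3)) ρ)) :=
        measure_mono (arcBall_subset_image c ρ)
    _ = haarProbability SU2 (expPoint '' ball (0 : EuclideanSpace ℝ (Fin 3)) ρ) := by
        rw [image_mul_left, measure_preimage_mul]
    _ = ENNReal.ofReal (∫ x in ball (0 : EuclideanSpace ℝ (Fin 3)) ρ, expWeight x) := haarProbability_image measurableSet_ball hsub
    _ ≤ ENNReal.ofReal (2 / (3 * π) * ρ ^ 3) := by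
        refine ENNReal.ofReal_le_ofReal ((integral_expWeight_ball_le hρ0).trans (le_of_eq ?_))
        field_simp
        ring

/-! ## §2 Finitely many arc-balls below the count do not cover: a far point exists -/

/-- ★★★ **A FINITE FAMILY OF CAP-CENTRES MISSES A POINT**: if `card ι · (2∕(3π))·ρ³ < 1` (`0 ≤ ρ ≤ π`) then some `p ∈ SU(2)` has arc `≥ ρ` from every `c i`
(the arc-balls have total Haar mass `< 1 = Haar(SU(2))`, so their union is not everything). [folklore] -/
theorem exists_forall_le_arc {ι : Type*} [Fintype ι] (c : ι → SU2) {ρ : ℝ} (hρ0 : 0 ≤ ρ) (hρπ : ρ ≤ π)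
    (hcard : (Fintype.card ι : ℝ) * (2 / (3 * π) * ρ ^ 3) < 1) :
    ∃ p : SU2, ∀ i, ρ ≤ ‖logVec (su2Quat ((c i)⁻¹ * p))‖ := by
  by_contra hne
  push Not at hne
  -- every `p` is inside some arc-ball: the union is `univ`
  have hcover : (univ : Set SU2) ⊆ ⋃ i, {p : SU2 | ‖logVec (su2Quat ((c i)⁻¹ * p))‖ < ρ} := by
    intro p _
    obtain ⟨i, hi⟩ := hne p
    exact mem_iUnion.2 ⟨i, hi⟩
  have hb0 : 0 ≤ 2 / (3 * π) * ρ ^ 3 := by positivity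
  have h1 : (1 : ENNReal) ≤ ENNReal.ofReal ((Fintype.card ι : ℝ) * (2 / (3 * π) * ρ ^ 3)) := by
    calc (1 : ENNReal) = haarProbability SU2 univ := measure_univ.symm
      _ ≤ haarProbability SU2 (⋃ i, {p : SU2 | ‖logVec (su2Quat ((c i)⁻¹ * p))‖ < ρ}) := measure_mono hcover
      _ ≤ ∑ i, haarProbability SU2 {p : SU2 | ‖logVec (su2Quat ((c i)⁻¹ * p))‖ < ρ} := measure_iUnion_fintype_le _ _
      _ ≤ ∑ _i : ι, ENNReal.ofReal (2 / (3 * π) * ρ ^ 3) := Finset.sum_le_sum fun i _ => haarProbability_arcBall_le (c i) hρ0 hρπ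
      _ = ENNReal.ofReal ((Fintype.card ι : ℝ) * (2 / (3 * π) * ρ ^ 3)) := by
          rw [Finset.sum_const, Finset.card_univ, nsmul_eq_mul, ENNReal.ofReal_mul (Nat.cast_nonneg _), ENNReal.ofReal_natCast]
  have h2 : ENNReal.ofReal ((Fintype.card ι : ℝ) * (2 / (3 * π) * ρ ^ 3)) < 1 := ENNReal.ofReal_lt_one.2 hcard
  exact absurd (lt_of_le_of_lt h1 h2) (lt_irrefl _)

/-! ## §3 The patched-family form (the consumer interface of §116.3 Stages T∕S) -/

/-- ★★★ **A PATCHED FINITE FAMILY MISSES A CAP**: if every member `φ k` of a family is within arc `r∕2` of one of finitely many centres `c i`, and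
`card ι · (2∕(3π))·(3r∕2)³ < 1` (`0 ≤ r`, `3r∕2 ≤ π`), then some `p ∈ SU(2)` is at arc `≥ r` from EVERY `φ k` (a point `3r∕2`-far from the centres is `r`-far from the
`r∕2`-patches: arc subadditivity ✓`norm_logVec_su2Quat_mul_le`). [folklore] -/
theorem exists_forall_le_arc_of_patched {ι κ : Type*} [Fintype ι] (c : ι → SU2) (φ : κ → SU2) {r : ℝ} (hr0 : 0 ≤ r) (hrπ : 3 * r / 2 ≤ π)
    (hpatch : ∀ k, ∃ i, ‖logVec (su2Quat ((c i)⁻¹ * φ k))‖ ≤ r / 2)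
    (hcard : (Fintype.card ι : ℝ) * (2 / (3 * π) * (3 * r / 2) ^ 3) < 1) :
    ∃ p : SU2, ∀ k, r ≤ ‖logVec (su2Quat ((φ k)⁻¹ * p))‖ := by
  obtain ⟨p, hp⟩ := exists_forall_le_arc c (by positivity) hrπ hcard
  refine ⟨p, fun k => ?_⟩
  obtain ⟨i, hi⟩ := hpatch k
  -- `(c i)⁻¹ p = ((c i)⁻¹ φ k) · ((φ k)⁻¹ p)`
  have hsplit : (c i)⁻¹ * p = (c i)⁻¹ * φ k * ((φ k)⁻¹ * p) := by group
  have hle := norm_logVec_su2Quat_mul_le ((c i)⁻¹ * φ k) ((φ k)⁻¹ * p)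
  rw [← hsplit] at hle
  have := hp i
  linarith

end Summit.QuantumFields.YangMills.Theorems.FluctuationComparisonRegPrIntLS2BetaHaarCapComplement

end
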